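import Summits.NavierStokesRegularity.TurbBounds.ShearCutoff
import Summits.NavierStokesRegularity.TurbBounds.Certs.S1000.Scalars

/-!
# Certificate S1000 (CERTIFIED.md row R1 = C1′, the HEADLINE shear certificate: FW16 2-D stress-driven shear, Γx 2, Gr 10³) — every mode beyond the cutoff is free

The scalar line `Certs.S1000.Scalars.cutoff : Γx²·T ≤ 2π²·(m_cert + 1)²` (T = ‖φ̂‖₁ ≥ ‖dφ/dζ‖_∞, m_cert = 14) fed into
`ShearCutoff.modes_free_nat`: for every 2-D wavenumber `α_m = 2πm/Γx` with `m ≥ 15` one has `2T ≤ α_m²`, which is the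
hypothesis of `ShearCutoff.mode_free` (FW16 (2.18)) — so only the modes m = 1 … 14 need LMI blocks (`Certs.S1000.B001 … B014`).
Pure instance file (pub-turb-shear gen 5); names written `S1000.Scalars.…` so the statement text differs from the S50 twin file (the gate's dedup lint is textual). HONEST FRAMING: rigorous bounds for the stated PDE and boundary conditions; no claim
about physical turbulence beyond the bound.
-/

namespace Summit.NavierStokesRegularity.TurbBounds.Certs.S1000

/-- **R1: all modes `m ≥ m_cert + 1 = 15` are free** (`2‖φ̂‖₁ ≤ α_m²`, the hypothesis of `ShearCutoff.mode_free`). -/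
theorem modes_free {m : ℕ} (hm : S1000.Scalars.mCert + 1 ≤ m) :
    2 * (S1000.Scalars.T : ℝ) ≤ (2 * Real.pi * (m : ℝ) / (S1000.Scalars.Gx : ℝ)) ^ 2 :=
  ShearCutoff.modes_free_nat (by norm_num [S1000.Scalars.Gx]) S1000.Scalars.cutoff hm

/-- In particular the first free mode is `m = 15`. -/
example : 2 * (S1000.Scalars.T : ℝ) ≤ (2 * Real.pi * (15 : ℕ) / (S1000.Scalars.Gx : ℝ)) ^ 2 :=
  modes_free (by decide)

end Summit.NavierStokesRegularity.TurbBounds.Certs.S1000
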